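import Mathlib.Analysis.Complex.LocallyUniformLimit
import Literature.NumberTheory.LFunctions.DeBruijnNewmanProofs
import HarnessLib

/-!
# The Pólya–de Bruijn kernel `Φ(u)` for COMPLEX `u`: holomorphy and size in the strip `|Im u| < π/8`

Topic `Literature/NumberTheory/LFunctions` (definition request `defn-deBruijnPhiC`, wanted by
`stmt-RiemannHypothesis-19214` = B1-rel `XiWindowZeroFreeRel` of the route `rh-jensen`: the proof
shifts a `Φ`-weighted integral from the real axis to the horizontal line through a saddle with
`|Im u_s| ≤ 0.09 < π/8`, by Mathlib's rectangle theorem, and needs `Φ` as a holomorphic function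
on that strip with an explicit majorant).

`Φ(u) = ∑_{n ≥ 1} (2π² n⁴ e^{9u} − 3π n² e^{5u}) exp(−π n² e^{4u})` (Rodgers–Tao 2020, eq. (2);
Titchmarsh §10.1; de Bruijn 1950) makes sense for complex `u` with `Re e^{4u} = e^{4 Re u} cos(4 Im u)
> 0`, i.e. `|Im u| < π/8` (mod `π/2`); there each summand is entire and the series converges
absolutely and locally uniformly.  This file defines

* `deBruijnPhiSummandC n u`, `deBruijnPhiC u = ∑' n, deBruijnPhiSummandC n u` — the same series
  as the tree's real kernel `deBruijnPhi` (`DeBruijnNewman.lean`), `u` complex (the real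
  coefficients `2π²(n+1)⁴`, `3π(n+1)²`, `π(n+1)²` are cast to `ℂ`);
* `deBruijnPhiStripMajorant x y n = (2π²(n+1)⁴e^{9x} + 3π(n+1)²e^{5x})·exp(−π(n+1)²e^{4x}cos(4y))`,

and PROVES the three statements asked for:

* (a) `deBruijnPhiC_ofReal : deBruijnPhiC u = deBruijnPhi u` for real `u`;
* (b) `differentiableOn_deBruijnPhiC : DifferentiableOn ℂ deBruijnPhiC {u | |u.im| < π/8}` (local
  uniform majorants on boxes + `differentiableOn_tsum_of_summable_norm`);
* (c) `norm_deBruijnPhiC_le : |y| < π/8 → ‖deBruijnPhiC (x + y I)‖ ≤ ∑' n, deBruijnPhiStripMajorant x y n`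
  (from `‖exp(−π n² e^{4(x+iy)})‖ = exp(−π n² e^{4x} cos 4y)`), with the summability of the majorant
  (`summable_deBruijnPhiStripMajorant`) and of the series (`summable_deBruijnPhiSummandC`).

No instances, no notation, no `sorry`, no named facts.

## References

* B. Rodgers, T. Tao, *The de Bruijn–Newman constant is non-negative*, Forum Math. Pi 8 (2020),
  §1 eq. (2) (the kernel `Φ`).
* E. C. Titchmarsh, *The theory of the Riemann zeta-function*, 2nd ed., §10.1 (`Φ` and `Ξ`).
* N. G. de Bruijn, *The roots of trigonometric integrals*, Duke Math. J. 17 (1950) (`Φ` as an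
  analytic kernel; the strip).
-/

noncomputable section

open Complex Real Set Filter Topology

namespace Literature.NumberTheory.LFunctions

/-! ## Definitions -/

/-- The `n`-th summand of the Pólya–de Bruijn kernel at a COMPLEX argument `u` (index shifted so
that it is the term `n + 1` of Rodgers–Tao eq. (2)):
`(2π²(n+1)⁴ e^{9u} − 3π(n+1)² e^{5u}) · exp(−π(n+1)² e^{4u})`, the real coefficients cast to `ℂ`
[cite: RodgersTao2020, §1 eq. (2)]. -/
def deBruijnPhiSummandC (n : ℕ) (u : ℂ) : ℂ :=
  (((2 * π ^ 2 * ((n : ℝ) + 1) ^ 4 : ℝ) : ℂ) * Complex.exp (9 * u) -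
      ((3 * π * ((n : ℝ) + 1) ^ 2 : ℝ) : ℂ) * Complex.exp (5 * u)) *
    Complex.exp (-(((π * ((n : ℝ) + 1) ^ 2 : ℝ) : ℂ) * Complex.exp (4 * u)))

/-- **The Pólya–de Bruijn kernel for complex `u`**:
`Φ(u) = ∑_{n ≥ 1} (2π² n⁴ e^{9u} − 3π n² e^{5u}) exp(−π n² e^{4u})` — the series of the tree's
`deBruijnPhi` with `u ∈ ℂ` (a `tsum`; it converges absolutely for `|Im u| < π/8`,
`summable_deBruijnPhiSummandC`) [cite: RodgersTao2020, §1 eq. (2)] [cite: Titchmarsh1986, §10.1]. -/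
def deBruijnPhiC (u : ℂ) : ℂ :=
  ∑' n : ℕ, deBruijnPhiSummandC n u

/-- The STRIP MAJORANT of the `n`-th summand at `u = x + iy`:
`(2π²(n+1)⁴ e^{9x} + 3π(n+1)² e^{5x}) · exp(−π(n+1)² e^{4x} cos(4y))` — the modulus of the Gaussian
factor is `exp(−π(n+1)² Re e^{4u}) = exp(−π(n+1)² e^{4x} cos 4y)` [cite: Titchmarsh1986, §10.1]. -/
def deBruijnPhiStripMajorant (x y : ℝ) (n : ℕ) : ℝ :=
  (2 * π ^ 2 * ((n : ℝ) + 1) ^ 4 * Real.exp (9 * x) + 3 * π * ((n : ℝ) + 1) ^ 2 * Real.exp (5 * x)) *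
    Real.exp (-(π * ((n : ℝ) + 1) ^ 2 * Real.exp (4 * x) * Real.cos (4 * y)))

/-! ## (a) Agreement with the real kernel -/

/-- On the real axis the complex summand is the real summand [cite: RodgersTao2020, §1 eq. (2)]. -/
@[simp]
theorem deBruijnPhiSummandC_ofReal (n : ℕ) (u : ℝ) :
    deBruijnPhiSummandC n (u : ℂ) = ((deBruijnPhiSummand n u : ℝ) : ℂ) := by
  unfold deBruijnPhiSummandC deBruijnPhiSummand
  push_cast
  ring_nf

/-- **(a)** `Φ_ℂ(u) = Φ(u)` for real `u` [cite: RodgersTao2020, §1 eq. (2)]. -/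
theorem deBruijnPhiC_ofReal (u : ℝ) : deBruijnPhiC (u : ℂ) = ((deBruijnPhi u : ℝ) : ℂ) := by
  unfold deBruijnPhiC deBruijnPhi
  rw [Complex.ofReal_tsum]
  exact tsum_congr fun n => deBruijnPhiSummandC_ofReal n u

/-! ## The size of one summand -/

/-- `Re e^{4u} = e^{4 Re u} cos(4 Im u)` [cite: Titchmarsh1986, §10.1]. -/
theorem re_cexp_four_mul (u : ℂ) :
    (Complex.exp (4 * u)).re = Real.exp (4 * u.re) * Real.cos (4 * u.im) := by
  rw [Complex.exp_re]
  simp [Complex.mul_re, Complex.mul_im]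

/-- `‖e^{c u}‖ = e^{c Re u}` for a numeral `c` [cite: Titchmarsh1986, §10.1]. -/
theorem norm_cexp_ofNat_mul (c : ℕ) [c.AtLeastTwo] (u : ℂ) :
    ‖Complex.exp ((OfNat.ofNat c : ℂ) * u)‖ = Real.exp ((OfNat.ofNat c : ℝ) * u.re) := by
  rw [Complex.norm_exp]
  simp [Complex.mul_re]

/-- The modulus of the Gaussian factor: `‖exp(−π(n+1)² e^{4u})‖ = exp(−π(n+1)² e^{4 Re u} cos(4 Im u))`
[cite: Titchmarsh1986, §10.1]. -/
theorem norm_cexp_deBruijnGaussFactor (n : ℕ) (u : ℂ) :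
    ‖Complex.exp (-(((π * ((n : ℝ) + 1) ^ 2 : ℝ) : ℂ) * Complex.exp (4 * u)))‖ =
      Real.exp (-(π * ((n : ℝ) + 1) ^ 2 * Real.exp (4 * u.re) * Real.cos (4 * u.im))) := by
  rw [Complex.norm_exp, Complex.neg_re, Complex.re_ofReal_mul, re_cexp_four_mul]
  ring_nf

/-- **Termwise strip bound**: `‖summand_n(u)‖ ≤ majorant(Re u, Im u, n)` for every complex `u`
[cite: Titchmarsh1986, §10.1]. -/
theorem norm_deBruijnPhiSummandC_le (n : ℕ) (u : ℂ) :
    ‖deBruijnPhiSummandC n u‖ ≤ deBruijnPhiStripMajorant u.re u.im n := by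
  have hA : 0 ≤ 2 * π ^ 2 * ((n : ℝ) + 1) ^ 4 := by positivity
  have hB : 0 ≤ 3 * π * ((n : ℝ) + 1) ^ 2 := by positivity
  have h9 : ‖((2 * π ^ 2 * ((n : ℝ) + 1) ^ 4 : ℝ) : ℂ) * Complex.exp (9 * u)‖ =
      2 * π ^ 2 * ((n : ℝ) + 1) ^ 4 * Real.exp (9 * u.re) := by
    rw [norm_mul, Complex.norm_real, Real.norm_of_nonneg hA, norm_cexp_ofNat_mul]
  have h5 : ‖((3 * π * ((n : ℝ) + 1) ^ 2 : ℝ) : ℂ) * Complex.exp (5 * u)‖ =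
      3 * π * ((n : ℝ) + 1) ^ 2 * Real.exp (5 * u.re) := by
    rw [norm_mul, Complex.norm_real, Real.norm_of_nonneg hB, norm_cexp_ofNat_mul]
  unfold deBruijnPhiSummandC deBruijnPhiStripMajorant
  rw [norm_mul, norm_cexp_deBruijnGaussFactor]
  gcongr
  exact (norm_sub_le _ _).trans (by rw [h9, h5])

/-- The majorant is non-negative [cite: Titchmarsh1986, §10.1]. -/
theorem deBruijnPhiStripMajorant_nonneg (x y : ℝ) (n : ℕ) :
    0 ≤ deBruijnPhiStripMajorant x y n := by
  unfold deBruijnPhiStripMajorant; positivity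

/-- `cos(4y) > 0` on the strip `|y| < π/8` [cite: Titchmarsh1986, §10.1]. -/
theorem cos_four_mul_pos {y : ℝ} (hy : |y| < π / 8) : 0 < Real.cos (4 * y) := by
  apply Real.cos_pos_of_mem_Ioo
  constructor <;> [have := neg_abs_le y; have := le_abs_self y] <;> linarith

/-- **Summability of the strip majorant** for `|y| < π/8` (polynomial times Gaussian with rate
`π e^{4x} cos 4y > 0`) [cite: Titchmarsh1986, §10.1]. -/
theorem summable_deBruijnPhiStripMajorant (x : ℝ) {y : ℝ} (hy : |y| < π / 8) :
    Summable (deBruijnPhiStripMajorant x y) := by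
  set r : ℝ := π * Real.exp (4 * x) * Real.cos (4 * y) with hr
  have hrpos : 0 < r := by
    have := cos_four_mul_pos hy
    positivity
  have h4 := (summable_succ_pow_mul_exp_neg_mul_sq 4 hrpos).mul_left (2 * π ^ 2 * Real.exp (9 * x))
  have h2 := (summable_succ_pow_mul_exp_neg_mul_sq 2 hrpos).mul_left (3 * π * Real.exp (5 * x))
  refine (h4.add h2).congr fun n => ?_
  unfold deBruijnPhiStripMajorant
  rw [hr]
  ring_nf

/-- Monotonicity of the majorant in the box parameters: if `x₀ ≤ x ≤ x₁` and `|y| ≤ y₁` with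
`4y₁ ≤ π/2`, then `majorant x y n ≤ (2π²(n+1)⁴e^{9x₁} + 3π(n+1)²e^{5x₁})·exp(−π(n+1)²e^{4x₀}cos(4y₁))`
[cite: Titchmarsh1986, §10.1]. -/
theorem deBruijnPhiStripMajorant_le {x x₀ x₁ y y₁ : ℝ} (hx₀ : x₀ ≤ x) (hx₁ : x ≤ x₁)
    (hy : |y| ≤ y₁) (hy₁ : 4 * y₁ ≤ π / 2) (n : ℕ) :
    deBruijnPhiStripMajorant x y n ≤
      (2 * π ^ 2 * ((n : ℝ) + 1) ^ 4 * Real.exp (9 * x₁) +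
          3 * π * ((n : ℝ) + 1) ^ 2 * Real.exp (5 * x₁)) *
        Real.exp (-(π * ((n : ℝ) + 1) ^ 2 * Real.exp (4 * x₀) * Real.cos (4 * y₁))) := by
  unfold deBruijnPhiStripMajorant
  have hcos : Real.cos (4 * y₁) ≤ Real.cos (4 * y) := by
    rw [← Real.cos_abs (4 * y)]
    refine Real.cos_le_cos_of_nonneg_of_le_pi (abs_nonneg _) (by linarith [Real.pi_pos]) ?_
    rw [abs_mul, abs_of_pos (by norm_num : (0 : ℝ) < 4)]
    linarith
  have hy₁nn : 0 ≤ y₁ := (abs_nonneg y).trans hy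
  have hcos₁ : 0 ≤ Real.cos (4 * y₁) :=
    Real.cos_nonneg_of_mem_Icc ⟨by linarith [Real.pi_pos], hy₁⟩
  have h1 : Real.exp (4 * x₀) ≤ Real.exp (4 * x) := Real.exp_le_exp.mpr (by linarith)
  have hkey : Real.exp (4 * x₀) * Real.cos (4 * y₁) ≤ Real.exp (4 * x) * Real.cos (4 * y) :=
    mul_le_mul h1 hcos hcos₁ (Real.exp_pos _).le
  have hexp : Real.exp (-(π * ((n : ℝ) + 1) ^ 2 * Real.exp (4 * x) * Real.cos (4 * y))) ≤
      Real.exp (-(π * ((n : ℝ) + 1) ^ 2 * Real.exp (4 * x₀) * Real.cos (4 * y₁))) := by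
    apply Real.exp_le_exp.mpr
    apply neg_le_neg
    have hc : 0 ≤ π * ((n : ℝ) + 1) ^ 2 := by positivity
    calc π * ((n : ℝ) + 1) ^ 2 * Real.exp (4 * x₀) * Real.cos (4 * y₁)
        = π * ((n : ℝ) + 1) ^ 2 * (Real.exp (4 * x₀) * Real.cos (4 * y₁)) := by ring
      _ ≤ π * ((n : ℝ) + 1) ^ 2 * (Real.exp (4 * x) * Real.cos (4 * y)) :=
          mul_le_mul_of_nonneg_left hkey hc
      _ = π * ((n : ℝ) + 1) ^ 2 * Real.exp (4 * x) * Real.cos (4 * y) := by ring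
  have hpoly : 2 * π ^ 2 * ((n : ℝ) + 1) ^ 4 * Real.exp (9 * x) +
        3 * π * ((n : ℝ) + 1) ^ 2 * Real.exp (5 * x) ≤
      2 * π ^ 2 * ((n : ℝ) + 1) ^ 4 * Real.exp (9 * x₁) +
        3 * π * ((n : ℝ) + 1) ^ 2 * Real.exp (5 * x₁) := by
    gcongr
  exact mul_le_mul hpoly hexp (Real.exp_pos _).le (by positivity)

/-! ## (c) The strip majorant of `Φ` -/

/-- The series for `Φ(u)` converges absolutely for `|Im u| < π/8`
[cite: Titchmarsh1986, §10.1]. -/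
theorem summable_norm_deBruijnPhiSummandC {u : ℂ} (hu : |u.im| < π / 8) :
    Summable fun n => ‖deBruijnPhiSummandC n u‖ :=
  (summable_deBruijnPhiStripMajorant u.re hu).of_nonneg_of_le (fun _ => norm_nonneg _)
    fun n => norm_deBruijnPhiSummandC_le n u

/-- [cite: Titchmarsh1986, §10.1] -/
theorem summable_deBruijnPhiSummandC {u : ℂ} (hu : |u.im| < π / 8) :
    Summable fun n => deBruijnPhiSummandC n u :=
  (summable_norm_deBruijnPhiSummandC hu).of_norm

/-- [cite: RodgersTao2020, §1 eq. (2)] -/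
theorem hasSum_deBruijnPhiC {u : ℂ} (hu : |u.im| < π / 8) :
    HasSum (fun n => deBruijnPhiSummandC n u) (deBruijnPhiC u) :=
  (summable_deBruijnPhiSummandC hu).hasSum

/-- **(c), `re/im` form**: `‖Φ(u)‖ ≤ ∑' n, majorant(Re u, Im u, n)` for `|Im u| < π/8`
[cite: Titchmarsh1986, §10.1]. -/
theorem norm_deBruijnPhiC_le_tsum (u : ℂ) (hu : |u.im| < π / 8) :
    ‖deBruijnPhiC u‖ ≤ ∑' n, deBruijnPhiStripMajorant u.re u.im n := by
  unfold deBruijnPhiC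
  refine (norm_tsum_le_tsum_norm (summable_norm_deBruijnPhiSummandC hu)).trans ?_
  exact (summable_norm_deBruijnPhiSummandC hu).tsum_le_tsum (fun n => norm_deBruijnPhiSummandC_le n u)
    (summable_deBruijnPhiStripMajorant u.re hu)

/-- **(c)** For real `x, y` with `|y| < π/8`:
`‖Φ(x + iy)‖ ≤ ∑' n, (2π²(n+1)⁴e^{9x} + 3π(n+1)²e^{5x}) · exp(−π(n+1)²e^{4x} cos(4y))`
[cite: Titchmarsh1986, §10.1]. -/
theorem norm_deBruijnPhiC_le (x y : ℝ) (hy : |y| < π / 8) :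
    ‖deBruijnPhiC (x + y * Complex.I)‖ ≤ ∑' n, deBruijnPhiStripMajorant x y n := by
  have hre : (x + y * Complex.I : ℂ).re = x := by simp
  have him : (x + y * Complex.I : ℂ).im = y := by simp
  have h := norm_deBruijnPhiC_le_tsum (x + y * Complex.I) (by rw [him]; exact hy)
  rwa [hre, him] at h

/-! ## (b) Holomorphy on the strip -/

/-- Each summand is an entire function of `u` [cite: Titchmarsh1986, §10.1]. -/
theorem differentiable_deBruijnPhiSummandC (n : ℕ) : Differentiable ℂ (deBruijnPhiSummandC n) := by
  unfold deBruijnPhiSummandC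
  fun_prop

/-- **(b)** `Φ` is holomorphic on the strip `|Im u| < π/8`: around each point the series has a
summable uniform majorant on an open box (growth factors bounded by `e^{9(x₀+1)}`, `e^{5(x₀+1)}`,
decay rate at least `π e^{4(x₀−1)} cos(4y₁)`, `y₁ = (π/8 + |y₀|)/2`), so it is a locally uniform
limit of entire functions [cite: Titchmarsh1986, §10.1] [cite: Bruijn1950, §1]. -/
theorem differentiableOn_deBruijnPhiC : DifferentiableOn ℂ deBruijnPhiC {u : ℂ | |u.im| < π / 8} := by
  intro u₀ hu₀
  simp only [Set.mem_setOf_eq] at hu₀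
  set x₀ : ℝ := u₀.re with hx₀
  set y₁ : ℝ := (π / 8 + |u₀.im|) / 2 with hy₁def
  have hy₁lt : y₁ < π / 8 := by rw [hy₁def]; linarith
  have hy₀lt : |u₀.im| < y₁ := by rw [hy₁def]; linarith
  have hy₁pi : 4 * y₁ ≤ π / 2 := by linarith [Real.pi_pos]
  have hy₁abs : |y₁| < π / 8 := by
    rw [abs_of_nonneg (by linarith [abs_nonneg u₀.im])]; exact hy₁lt
  set U : Set ℂ := {u : ℂ | u.re ∈ Set.Ioo (x₀ - 1) (x₀ + 1) ∧ |u.im| < y₁} with hU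
  have hUo : IsOpen U := by
    refine IsOpen.inter (isOpen_Ioo.preimage Complex.continuous_re) ?_
    exact isOpen_lt (continuous_abs.comp Complex.continuous_im) continuous_const
  have hu₀U : u₀ ∈ U := ⟨⟨by linarith, by linarith⟩, hy₀lt⟩
  -- the uniform majorant on the box
  set M : ℕ → ℝ := fun n =>
    (2 * π ^ 2 * ((n : ℝ) + 1) ^ 4 * Real.exp (9 * (x₀ + 1)) +
        3 * π * ((n : ℝ) + 1) ^ 2 * Real.exp (5 * (x₀ + 1))) *
      Real.exp (-(π * ((n : ℝ) + 1) ^ 2 * Real.exp (4 * (x₀ - 1)) * Real.cos (4 * y₁))) with hM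
  have hMsum : Summable M := by
    set r : ℝ := π * Real.exp (4 * (x₀ - 1)) * Real.cos (4 * y₁) with hr
    have hrpos : 0 < r := by
      have := cos_four_mul_pos hy₁abs
      positivity
    have h4 := (summable_succ_pow_mul_exp_neg_mul_sq 4 hrpos).mul_left
      (2 * π ^ 2 * Real.exp (9 * (x₀ + 1)))
    have h2 := (summable_succ_pow_mul_exp_neg_mul_sq 2 hrpos).mul_left
      (3 * π * Real.exp (5 * (x₀ + 1)))
    refine (h4.add h2).congr fun n => ?_
    rw [hM, hr]
    ring_nf
  have hle : ∀ (n : ℕ) (w : ℂ), w ∈ U → ‖deBruijnPhiSummandC n w‖ ≤ M n := by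
    rintro n w ⟨⟨hw₁, hw₂⟩, hw₃⟩
    exact (norm_deBruijnPhiSummandC_le n w).trans
      (deBruijnPhiStripMajorant_le hw₁.le hw₂.le hw₃.le hy₁pi n)
  have hdiff : DifferentiableOn ℂ (fun w => ∑' n, deBruijnPhiSummandC n w) U :=
    differentiableOn_tsum_of_summable_norm hMsum
      (fun n => (differentiable_deBruijnPhiSummandC n).differentiableOn) hUo hle
  exact ((hdiff u₀ hu₀U).differentiableAt (hUo.mem_nhds hu₀U)).differentiableWithinAt

/-- Pointwise form of (b): `Φ` is complex-differentiable at every `u` with `|Im u| < π/8`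
[cite: Titchmarsh1986, §10.1]. -/
theorem differentiableAt_deBruijnPhiC {u : ℂ} (hu : |u.im| < π / 8) :
    DifferentiableAt ℂ deBruijnPhiC u :=
  (differentiableOn_deBruijnPhiC u hu).differentiableAt
    ((isOpen_lt (continuous_abs.comp Complex.continuous_im) continuous_const).mem_nhds hu)

end Literature.NumberTheory.LFunctions
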